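import Summits.CriticalPhenomena.CardyFormulaZ2.Theses.CardySelfRefinement
import Literature.Probability.RandomPlanarGeometry.SLEUniquenessInLaw
import Literature.Probability.LatticeModels.MedialInterfaceMeasurability

/-!
# Disproof of `SubseqUpgrade` — findings: NO KILL, the crux is a THEOREM

Crux `stmt-CriticalPhenomena-10279` = `CardySelfRefinement.SubseqUpgrade` (auto-crux'd by the gate
only because its docstring contains the word "conjecture" — it refers to the *inlined* Literature
constant `SLE6LimitZ2AllDiscretisations`, not to this implication).

Findings of the standing disprover (refuter-cdisprove-stmt-CriticalPhenomena-10279-0), all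
kernel-checked below unless marked otherwise:

1. **The crux holds outright**: `subseqUpgrade_holds'` (section `Positive`) proves
   `CardySelfRefinement.SubseqUpgrade` sorry-free from the tree as it stands
   (uniqueness of the chordal SLE_κ law `IsSLELaw.eq_map_of_isSLECurve` /
   `IsSLECurve.map_eq_holds` in `SLEUniquenessInLaw.lean`, axioms `propext, Classical.choice,
   Quot.sound`; `Filter.tendsto_of_subseq_tendsto` on the countably generated filter `𝓝[>] 0`;
   `MeasureTheory.integral_map`). The same proof is attached to the item as evidence `Proof.lean`
   (theorem `Summit.CriticalPhenomena.CardyFormulaZ2.Theorems.subseqUpgrade_holds`) for a prover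
   to land — a refuter may not land positive Theses conclusions. **No disproof exists.**
2. **Abstract core and load-bearing analysis** (section `Abstract`): the principle
   `SubseqPrinciple S g` — "every positive null sequence of meshes has a subsequence along which
   `g` converges to a point of `S`" ⇒ "`g` converges along `𝓝[>] 0` to a point of `S`" — holds
   when `S` is a subsingleton (`subseqPrinciple_of_subsingleton`; this is exactly what uniqueness
   of the SLE₆ law supplies) and FAILS for a two-point target set
   (`not_subseqPrinciple_pair`, witness: the indicator of the mesh set `{1/(n+1)}` tested along
   `1/(n+1)` and `1/(n+3/2)`). So "the subsequential limits are SLE₆ laws of the SAME Dobrushin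
   domain" is the load-bearing clause of (H2): any proof must use `IsSLELaw` uniqueness, and the
   tree has it.
3. **Hypotheses that are NOT load-bearing** (section `Weakening`): the route states (H2) with ONE
   subsequence and ONE chordal family `P` serving all `(D, E)` at once and with `StrictMono φ`.
   `convergesInLawToSLE_of_subseq` shows the conclusion already follows, for each `(D, E)`
   separately, from a per-`(D,E)` subsequence with `Tendsto φ atTop atTop` and a per-`(D,E)` SLE₆
   limit law; `subseqUpgradePerDomain_holds` is the correspondingly STRONGER statement (weaker
   hypothesis), also proved. (H1) (eventual a.e.-measurability) is used only verbatim, as the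
   measurability clause of `ConvergesInLawToSLE`.
4. **Vacuity**: (H2) contains the open conjecture itself (subsequential SLE₆ limits of the bond-ℤ²
   interface), so its satisfiability is unknown but not junk-vacuous: junk-vacuity would need a
   Dobrushin domain with no chordal SLE₆ law, i.e. `¬ exists_isSLECurve` (named fact of
   `SLE.lean`, Rohde–Schramm Thm 5.1 + 7.1 + Carathéodory; believed, unproved in tree).
   `DobrushinDomain = MarkedDomain 2` (Jordan domain, two strictly ordered marks) has no
   degenerate inhabitants to exploit.
5. Searched for counterexample families: none applicable — the statement is a soft
   topology/measure-theory fact (Billingsley 1999, Thm 2.6; Lawler 2005, §6.1/6.3), independent of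
   percolation.

Cycle 2 (re-arm: skeleton `Lines/uniqueness-pin-subsequence.lean` registered, stubs
`stub_uniquenessPin`, `stub_lawCriterion`; no stuck stubs):

6. **Targets** (section `Targets`): both registered stubs are THEOREMS — `lawCriterion_holds`,
   `slePin_holds` (independent proofs of the verbatim statements `LawCriterion`, `SLEPin`); no
   `stub_…_false` exists, the lead can land the line as planned.
7. **What the targets' proofs must use / may drop**: `not_lawCriterionOnMesh` — the law criterion
   is FALSE when its hypothesis is asked only of mesh sequences with values in the lattice mesh set
   `{1/(m+1)}` (witness: deterministic oscillator under Dirac laws, test function `clamp`): every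
   positive null sequence is load-bearing, so an upstream discharge of (H2) along `δ = 1/n` only
   does NOT feed the crux; `lawCriterion_pointwise` — `f`-dependent subsequences (and
   `Tendsto φ atTop atTop`) suffice; `exists_subseq_tendsto_integral` — for probability laws such
   per-`f` convergent subsequences always exist (Bolzano–Weierstrass), so the whole content of (H2)
   is the IDENTIFICATION of the limits as `∫ f dμ`, `μ` one chordal SLE₆ law; `not_pinWithoutSLE` —
   the pin with that identification deleted is FALSE (curve-valued oscillator between two constant
   curves, separated by `sepTest`): measure-level form of `not_subseqPrinciple_pair`.
8. **Tightness** (section `Tightness`): `hyp_of_concl` / `hyp_iff_concl` — modulo an SLE₆ law in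
   every Dobrushin domain (`forall_exists_isSLELaw_six` from the named fact `exists_isSLECurve`),
   the CONCLUSION of the crux implies its HYPOTHESIS (H1) ∧ (H2) (identity subsequence, one chordal
   family for all sequences): the crux is an equivalence, (H2) cannot be weakened in substance.

Cycle 3 (re-arm, gen 2; no stuck stubs; the crux is still open only because no prover has landed
one of the ≥ 6 proofs yet) — section `Cycle3`, all kernel-checked, landing copy
`Theorems/SubseqUpgrade/Negative/MeshSetsAndHits.lean`:

9. **The weakest form of (H2) — hits — and it is an equivalence**:
   `tendstoLaw_iff_forall_seq_exists_mem` — `TendstoLaw Y P Z P'` ⟺ for every test function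
   `f`, every neighbourhood `U` of the limit statistic and every everywhere-positive null mesh
   sequence, SOME mesh of the sequence has its `f`-statistic in `U`. So the reindexing `φ` of
   (H2) may be ARBITRARY (no `StrictMono`, not even `φ → ∞`), `f`-dependent, `(D,E)`-dependent:
   the extraction clause carries NO content; `concl_of_h2Hit` / `h2Hit_iff_concl` — the crux
   from SLE₆-hits alone, and (modulo SLE₆ existence) hits ⟺ conclusion; `subseqUpgrade_of_hits`
   is a 7th proof of the crux through this weakest interface.
10. **Which mesh sequences must be controlled — a DICHOTOMY** (`LawCriterionOn T` = the law
   criterion with its hypothesis asked only of `T`-valued sequences, strongest hypothesis form):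
   `lawCriterionOn_iff` — `LawCriterionOn T ↔ T ∈ 𝓝[>] 0`. Sufficiency even for strictly
   DECREASING `T`-valued sequences in hit form (`tendstoLaw_of_hits_on`, via
   `exists_strictAnti_subseq`, infinitary Erdős–Szekeres); necessity by the indicator-of-`T`
   oscillator (`not_lawCriterion_on_of_not_mem_nhdsWithin`). Corollaries: NO COUNTABLE mesh set
   suffices (`not_lawCriterionOn_of_countable`; `not_lawCriterionOn_range`: not the values /
   subsequences of any single sequence — `1/(m+1)`, `2⁻ⁿ`, …; `not_lawCriterionOn_meshSet`
   recovers item 7), while `LawCriterionOn (Set.Ioo 0 ε)` holds for every `ε > 0`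
   (`lawCriterionOn_Ioo`). Upstream (LagHandOff → SymmetryUpgrade) may therefore assume the mesh
   sequence strictly decreasing and below any fixed `ε`, but must cover a continuum of meshes;
   `concl_of_h2Hit_on` is the directly consumable strengthened crux (hits along strictly
   decreasing sequences in `(0, ε)` ⇒ conclusion).
11. **(H1) is a THEOREM**: `measurable_bondInterfaceIn_all` — the bond interface
   `bondInterfaceIn D E` is Borel measurable for EVERY `D`, `E` (no admissibility / finiteness /
   `δ > 0`: factorisation through the countable medial exploration,
   `measurable_of_medialExploration`), hence `subseqUpgrade_h1` = (H1) verbatim and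
   `hyp_iff_h2` — the hypothesis of the crux is (H2) alone. (The LagHandOff disprover landed the
   family version `LagHandOff.Negative.lagHandOff_clause_i`; this one is unconditional.)
12. No natural strengthening of the crux in the direction "fewer sequences" survives beyond
   item 10's boundary, and no weakening of the convergence clause below "hits" is possible
   (item 9 is an iff): the load-bearing content of (H2) is exactly "the `f`-statistics of the
   interface do not stay away from the SLE₆ value along any mesh sequence", i.e. the scaling
   limit itself. No disproof exists; nothing here is sorried.
-/

open Filter MeasureTheory Topology
open scoped NNReal BoundedContinuousFunction
open Literature.Probability.RandomPlanarGeometry Literature.Probability.LatticeModels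
  Literature.Probability.Percolation

namespace Summit.CriticalPhenomena.CardyFormulaZ2.Cruxes.SubseqUpgrade.Disproof

/-! ## Abstract — the subsequence principle and its load-bearing hypothesis -/
section Abstract

/-- The abstract subsequence principle along the mesh filter `𝓝[>] 0` with limits constrained to
a target set `S`: if every everywhere-positive null sequence of meshes has a subsequence along
which `g` converges to SOME point of `S`, then `g` converges along `𝓝[>] 0` to some point of `S`.
Billingsley (1999), Thm. 2.6 is the case `S` = one law. [folklore] -/
def SubseqPrinciple {α : Type*} [TopologicalSpace α] (S : Set α) (g : ℝ → α) : Prop :=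
  (∀ δs : ℕ → ℝ, (∀ n, 0 < δs n) → Tendsto δs atTop (𝓝 0) →
      ∃ φ : ℕ → ℕ, StrictMono φ ∧ ∃ a ∈ S, Tendsto (fun n => g (δs (φ n))) atTop (𝓝 a)) →
    ∃ a ∈ S, Tendsto g (𝓝[>] (0 : ℝ)) (𝓝 a)

/-- A sequence tending to `0` within `(0, ∞)` agrees eventually with an everywhere-positive null
sequence. [folklore] -/
theorem exists_pos_seq_eventuallyEq {ns : ℕ → ℝ} (hns : Tendsto ns atTop (𝓝[>] (0 : ℝ))) :
    ∃ δs : ℕ → ℝ, (∀ n, 0 < δs n) ∧ Tendsto δs atTop (𝓝 0) ∧ δs =ᶠ[atTop] ns := by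
  have hns0 : Tendsto ns atTop (𝓝 0) := (tendsto_nhdsWithin_iff.1 hns).1
  have hpos : ∀ᶠ n in atTop, 0 < ns n := (tendsto_nhdsWithin_iff.1 hns).2
  refine ⟨fun n => if 0 < ns n then ns n else 1 / ((n : ℝ) + 1), fun n => ?_, ?_, ?_⟩
  · by_cases h : 0 < ns n
    · simp [h]
    · simp only [if_neg h]; positivity
  · refine hns0.congr' (hpos.mono fun n hn => ?_)
    simp [hn]
  · exact hpos.mono fun n hn => by simp [hn]

/-- **The principle holds for a subsingleton target** — the abstract core of `SubseqUpgrade`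
(there `S` = the set of chordal SLE₆ laws of `(D; a, b)`, a singleton by `IsSLELaw.unique'`).
Billingsley (1999), Thm. 2.6. [folklore] -/
theorem subseqPrinciple_of_subsingleton {α : Type*} [TopologicalSpace α] {S : Set α}
    (hS : S.Subsingleton) (g : ℝ → α) : SubseqPrinciple S g := by
  intro h
  obtain ⟨-, -, a, ha, -⟩ := h (fun n => 1 / ((n : ℝ) + 1)) (fun n => by positivity)
    tendsto_one_div_add_atTop_nhds_zero_nat
  refine ⟨a, ha, tendsto_of_subseq_tendsto fun ns hns => ?_⟩
  obtain ⟨δs, hδpos, hδlim, hδeq⟩ := exists_pos_seq_eventuallyEq hns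
  obtain ⟨φ, hφ, b, hb, hconv⟩ := h δs hδpos hδlim
  obtain rfl : b = a := hS hb ha
  exact ⟨φ, hconv.congr' ((hφ.tendsto_atTop.eventually hδeq).mono fun n hn => by rw [hn])⟩

/-- Witness for the failure of the principle with a two-point target: the indicator of the mesh
set `{1/(n+1) : n ∈ ℕ}`. [folklore] -/
noncomputable def oscillator : ℝ → ℝ :=
  Set.indicator (Set.range fun n : ℕ => 1 / ((n : ℝ) + 1)) 1

theorem oscillator_mesh (n : ℕ) : oscillator (1 / ((n : ℝ) + 1)) = 1 := by
  unfold oscillator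
  rw [Set.indicator_of_mem (Set.mem_range_self n)]
  rfl

theorem oscillator_offmesh (n : ℕ) : oscillator (1 / ((n : ℝ) + 3 / 2)) = 0 := by
  unfold oscillator
  rw [Set.indicator_of_notMem]
  rintro ⟨m, hm⟩
  have h1 : (0 : ℝ) < (m : ℝ) + 1 := by positivity
  have h2 : (0 : ℝ) < (n : ℝ) + 3 / 2 := by positivity
  have h : (m : ℝ) + 1 = (n : ℝ) + 3 / 2 := by
    have := hm
    field_simp at this
    linarith
  have h' : (2 * m + 2 : ℝ) = 2 * n + 3 := by linarith
  norm_cast at h'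
  omega

/-- **`uniqueness of the limit law` is load-bearing**: with a two-point target set the
subsequence principle fails (every sequence has a subsequence on which the `{0,1}`-valued
`oscillator` is constant, yet `oscillator` has no limit at `0⁺`). Hence any proof of
`SubseqUpgrade` must use that two chordal SLE₆ laws of the same Dobrushin domain coincide
(`IsSLELaw.unique'`). [folklore] -/
theorem not_subseqPrinciple_pair : ¬ SubseqPrinciple ({0, 1} : Set ℝ) oscillator := by
  intro h
  have hyp : ∀ δs : ℕ → ℝ, (∀ n, 0 < δs n) → Tendsto δs atTop (𝓝 0) →
      ∃ φ : ℕ → ℕ, StrictMono φ ∧ ∃ a ∈ ({0, 1} : Set ℝ),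
        Tendsto (fun n => oscillator (δs (φ n))) atTop (𝓝 a) := by
    intro δs _ _
    by_cases hf : ∃ᶠ n in atTop, δs n ∈ Set.range fun m : ℕ => 1 / ((m : ℝ) + 1)
    · obtain ⟨φ, hφ, hφ'⟩ := extraction_of_frequently_atTop hf
      refine ⟨φ, hφ, 1, by simp, ?_⟩
      have : (fun n => oscillator (δs (φ n))) = fun _ => 1 := funext fun n => by
        unfold oscillator
        rw [Set.indicator_of_mem (hφ' n)]
        rfl
      rw [this]
      exact tendsto_const_nhds
    · obtain ⟨φ, hφ, hφ'⟩ := extraction_of_eventually_atTop (not_frequently.1 hf)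
      refine ⟨φ, hφ, 0, by simp, ?_⟩
      have : (fun n => oscillator (δs (φ n))) = fun _ => 0 := funext fun n => by
        unfold oscillator
        rw [Set.indicator_of_notMem (hφ' n)]
      rw [this]
      exact tendsto_const_nhds
  obtain ⟨a, -, hlim⟩ := h hyp
  -- along the mesh set the oscillator is 1
  have hseq1 : Tendsto (fun n : ℕ => 1 / ((n : ℝ) + 1)) atTop (𝓝[>] (0 : ℝ)) :=
    tendsto_nhdsWithin_iff.2 ⟨tendsto_one_div_add_atTop_nhds_zero_nat,
      Eventually.of_forall fun n => Set.mem_Ioi.2 (by positivity)⟩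
  have h1 := hlim.comp hseq1
  have h1' : ((oscillator ∘ fun n : ℕ => 1 / ((n : ℝ) + 1))) = fun _ => 1 :=
    funext fun n => oscillator_mesh n
  rw [h1'] at h1
  have ha1 : a = 1 := tendsto_nhds_unique h1 tendsto_const_nhds ▸ rfl
  -- along the shifted set it is 0
  have hseq0 : Tendsto (fun n : ℕ => 1 / ((n : ℝ) + 3 / 2)) atTop (𝓝[>] (0 : ℝ)) := by
    refine tendsto_nhdsWithin_iff.2 ⟨?_, Eventually.of_forall fun n => Set.mem_Ioi.2 (by positivity)⟩
    have : Tendsto (fun n : ℕ => (n : ℝ) + 3 / 2) atTop atTop :=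
      tendsto_atTop_add_const_right _ _ tendsto_natCast_atTop_atTop
    exact tendsto_const_nhds.div_atTop this
  have h0 := hlim.comp hseq0
  have h0' : ((oscillator ∘ fun n : ℕ => 1 / ((n : ℝ) + 3 / 2))) = fun _ => 0 :=
    funext fun n => oscillator_offmesh n
  rw [h0'] at h0
  have ha0 : a = 0 := tendsto_nhds_unique h0 tendsto_const_nhds ▸ rfl
  exact one_ne_zero (ha1.symm.trans ha0)

end Abstract

/-! ## Weakening — the general criterion with per-domain subsequences (hypotheses NOT load-bearing) -/
section Weakening

/-- **Convergence in law to chordal SLE_κ from subsequential identification alone** (general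
configuration spaces): eventual a.e.-measurability plus "every everywhere-positive null sequence
of meshes has a subsequence (`Tendsto φ atTop atTop` suffices) along which the laws of `X` converge
to SOME chordal SLE_κ law of `(D; a, b)`" gives `ConvergesInLawToSLE κ D X P`. No tightness
hypothesis and no single subsequence for all domains are needed: uniqueness of the SLE_κ law
(`IsSLELaw.eq_map_of_isSLECurve`) and `tendsto_of_subseq_tendsto` on `𝓝[>] 0`.
Billingsley (1999), Thm. 2.6; Lawler (2005), §6.3. [folklore] -/
theorem convergesInLawToSLE_of_subseq {Ωδ : ℝ → Type*} [∀ δ, MeasurableSpace (Ωδ δ)]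
    {κ : ℝ≥0} {D : DobrushinDomain} {X : ∀ δ, Ωδ δ → CurveClass ℂ} {P : ∀ δ, Measure (Ωδ δ)}
    (hX : ∀ᶠ δ in 𝓝[>] (0 : ℝ), AEMeasurable (X δ) (P δ))
    (hsub : ∀ δs : ℕ → ℝ, (∀ n, 0 < δs n) → Tendsto δs atTop (𝓝 0) →
      ∃ φ : ℕ → ℕ, Tendsto φ atTop atTop ∧ ∃ μ : Measure (CurveClass ℂ), IsSLELaw κ D μ ∧
        ∀ f : BoundedContinuousFunction (CurveClass ℂ) ℝ,
          Tendsto (fun n => ∫ ω, f (X (δs (φ n)) ω) ∂(P (δs (φ n)))) atTop (𝓝 (∫ γ, f γ ∂μ))) :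
    ConvergesInLawToSLE κ D X P := by
  obtain ⟨-, -, μ₀, hμ₀, -⟩ := hsub (fun n => 1 / ((n : ℝ) + 1)) (fun n => by positivity)
    tendsto_one_div_add_atTop_nhds_zero_nat
  obtain ⟨Γ, hΓ, -⟩ := hμ₀
  refine ⟨Γ, hΓ, hX, fun f => tendsto_of_subseq_tendsto fun ns hns => ?_⟩
  obtain ⟨δs, hδpos, hδlim, hδeq⟩ := exists_pos_seq_eventuallyEq hns
  obtain ⟨φ, hφ, μ, hμ, hconv⟩ := hsub δs hδpos hδlim
  have hμΓ : μ = Literature.Probability.Process.preWienerMeasure.map Γ := hμ.eq_map_of_isSLECurve hΓ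
  refine ⟨φ, ?_⟩
  have h1 := hconv f
  rw [hμΓ, integral_map hΓ.aemeasurable f.continuous.aestronglyMeasurable] at h1
  exact h1.congr' ((hφ.eventually hδeq).mono fun n hn =>
    congrArg (fun δ => ∫ ω, f (X δ ω) ∂(P δ)) hn)

/-- `SubseqUpgrade` with hypothesis (H2) WEAKENED to per-`(D,E)` data: the subsequence and the
SLE₆ limit law may depend on the Dobrushin domain and on the discretisation family (no single
chordal family `P` for all domains at once), and `StrictMono φ` is relaxed to
`Tendsto φ atTop atTop`. A STRONGER statement than the crux. [folklore] -/
def SubseqUpgradePerDomain : Prop :=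
  ((∀ (D : DobrushinDomain) (E : ℝ → DiscreteDobrushin), ZdDiscretisationFamily D E →
      ∀ᶠ δ in 𝓝[>] (0 : ℝ), AEMeasurable (bondInterfaceIn D (E δ))
        (bondPercolation (zdGraph 2) half)) ∧
    ∀ (D : DobrushinDomain) (E : ℝ → DiscreteDobrushin), ZdDiscretisationFamily D E →
      ∀ δs : ℕ → ℝ, (∀ n, 0 < δs n) → Tendsto δs atTop (𝓝 0) →
        ∃ φ : ℕ → ℕ, Tendsto φ atTop atTop ∧ ∃ μ : Measure (CurveClass ℂ), IsSLELaw 6 D μ ∧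
          ∀ f : BoundedContinuousFunction (CurveClass ℂ) ℝ,
            Tendsto (fun n => ∫ ω, f (bondInterfaceIn D (E (δs (φ n))) ω)
              ∂(bondPercolation (zdGraph 2) half)) atTop (𝓝 (∫ γ, f γ ∂μ))) →
  ∀ (D : DobrushinDomain) (E : ℝ → DiscreteDobrushin), ZdDiscretisationFamily D E →
    ConvergesInLawToSLE 6 D (Ωδ := fun _ => BondConfig (Site 2))
      (fun δ => bondInterfaceIn D (E δ)) (fun _ => bondPercolation (zdGraph 2) half)

/-- The stronger per-domain form holds. [folklore] -/
theorem subseqUpgradePerDomain_holds : SubseqUpgradePerDomain :=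
  fun ⟨hmeas, hsub⟩ D E hDE => convergesInLawToSLE_of_subseq (hmeas D E hDE) (hsub D E hDE)

/-- The route's hypothesis (one subsequence and one chordal family for all `(D,E)`, `StrictMono φ`)
implies the per-domain hypothesis, so the crux follows from the stronger form. [folklore] -/
theorem subseqUpgrade_of_perDomain (h : SubseqUpgradePerDomain) :
    Summit.CriticalPhenomena.CardyFormulaZ2.Theses.CardySelfRefinement.SubseqUpgrade := by
  rintro ⟨hmeas, hsub⟩
  refine h ⟨hmeas, fun D E hDE δs hpos hlim => ?_⟩
  obtain ⟨φ, hφ, P, hP, hconv⟩ := hsub δs hpos hlim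
  exact ⟨φ, hφ.tendsto_atTop, P D, hP D, hconv D E hDE⟩

end Weakening

/-! ## Positive — the crux itself (refuter evidence `Proof.lean`; a prover lands it) -/
section Positive

/-- **`CardySelfRefinement.SubseqUpgrade` holds.** (Identical in content to the evidence file
`Proof.lean`, theorem `Summit.CriticalPhenomena.CardyFormulaZ2.Theorems.subseqUpgrade_holds`,
attached to item stmt-CriticalPhenomena-10279.) Billingsley (1999), Thm. 2.6; Lawler (2005),
§6.1, §6.3. [folklore] -/
theorem subseqUpgrade_holds' :
    Summit.CriticalPhenomena.CardyFormulaZ2.Theses.CardySelfRefinement.SubseqUpgrade :=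
  subseqUpgrade_of_perDomain subseqUpgradePerDomain_holds

end Positive

/-! ## Targets — cycle 2: the registered skeleton `Lines/uniqueness-pin-subsequence.lean`

The crux item now carries the skeleton `uniqueness-pin-subsequence` (ledger skeleton sha
`9603d8e8e015…`) with two registered stubs, restated VERBATIM below as `LawCriterion`
(`stub_lawCriterion`) and `SLEPin` (`stub_uniquenessPin`). Findings (all kernel-checked):

* both targets are THEOREMS (`lawCriterion_holds`, `slePin_holds`: independent proofs; the
  planner's `Proofs.lawCriterion_holds` / `Proofs.slePin_holds` in the Lines file agree) — there is
  no `stub_…_false`;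
* `not_lawCriterionOnMesh` — **all positive null mesh sequences are load-bearing**: the law
  criterion FAILS if its hypothesis is asked only of sequences of standard meshes `1/(m+1)` (in
  particular of all subsequences of the harmonic mesh sequence): a deterministic "interface" equal
  to one value on the mesh set and another off it has all its lattice subsequential limits right
  and still no limit along the continuum filter `𝓝[>] 0`. Consequence for whoever DISCHARGES (H2)
  upstream (LagHandOff → SymmetryUpgrade): a scaling limit stated along `δ = 1/n` or `2⁻ⁿ` only
  does not feed this crux; (H2) genuinely quantifies over every positive null sequence;
* `lawCriterion_pointwise` — an `f`-DEPENDENT subsequence suffices (strengthening that still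
  holds), and `exists_subseq_tendsto_integral` — for probability laws such per-`f` convergent
  subsequences ALWAYS exist (Bolzano–Weierstrass): the content of (H2) is the IDENTIFICATION of
  the limit values as `∫ f dμ` for one SLE₆ law `μ`, not the existence of convergent subsequences;
* `not_pinWithoutSLE` — the pin with the constraint "the subsequential limit law is a chordal
  SLE_κ law of `(D; a, b)`" deleted is FALSE (curve-valued oscillator between two constant
  curves; Dirac limit laws): the measure-level form of `not_subseqPrinciple_pair`.
-/
section Targets

/-- **Target `stub_lawCriterion`, verbatim** (skeleton `uniqueness-pin-subsequence`): the shifted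
subsequence principle for `TendstoLaw`. Billingsley (1999), Thm. 2.6. [folklore] -/
def LawCriterion : Prop :=
  ∀ {Ωδ : ℝ → Type} [∀ δ, MeasurableSpace (Ωδ δ)] {Ω' : Type} [MeasurableSpace Ω']
    {X : Type} [TopologicalSpace X]
    (Y : ∀ δ, Ωδ δ → X) (P : ∀ δ, Measure (Ωδ δ)) (Z : Ω' → X) (P' : Measure Ω'),
    (∀ s : ℕ → ℝ, (∀ n, 0 < s n) → Tendsto s atTop (𝓝 0) →
        ∃ φ : ℕ → ℕ, StrictMono φ ∧ ∀ f : X →ᵇ ℝ,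
          Tendsto (fun n ↦ ∫ ω, f (Y (s (φ n)) ω) ∂P (s (φ n))) atTop
            (𝓝 (∫ ω, f (Z ω) ∂P'))) →
      TendstoLaw Y P Z P'

/-- **Target `stub_uniquenessPin`, verbatim** (skeleton `uniqueness-pin-subsequence`): the
uniqueness pin. Lawler (2005), §6.1/§6.3. [folklore] -/
def SLEPin : Prop :=
  ∀ (κ : ℝ≥0) (D : DobrushinDomain) {Ωδ : ℝ → Type} [∀ δ, MeasurableSpace (Ωδ δ)]
    (Y : ∀ δ, Ωδ δ → CurveClass ℂ) (P : ∀ δ, Measure (Ωδ δ)),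
    (∀ s : ℕ → ℝ, (∀ n, 0 < s n) → Tendsto s atTop (𝓝 0) →
        ∃ φ : ℕ → ℕ, StrictMono φ ∧ ∃ μ : Measure (CurveClass ℂ), IsSLELaw κ D μ ∧
          ∀ f : CurveClass ℂ →ᵇ ℝ,
            Tendsto (fun n ↦ ∫ ω, f (Y (s (φ n)) ω) ∂P (s (φ n))) atTop (𝓝 (∫ x, f x ∂μ))) →
      ∃ Γ : (ℝ≥0 → ℝ) → CurveClass ℂ, IsSLECurve κ D Γ ∧
        ∀ s : ℕ → ℝ, (∀ n, 0 < s n) → Tendsto s atTop (𝓝 0) →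
          ∃ φ : ℕ → ℕ, StrictMono φ ∧ ∀ f : CurveClass ℂ →ᵇ ℝ,
            Tendsto (fun n ↦ ∫ ω, f (Y (s (φ n)) ω) ∂P (s (φ n))) atTop
              (𝓝 (∫ ω, f (Γ ω) ∂Literature.Probability.Process.preWienerMeasure))

/-- **Status of target `stub_lawCriterion`: a theorem** (independent proof; positivity repair by
value patch, `exists_pos_seq_eventuallyEq`). Billingsley (1999), Thm. 2.6. [folklore] -/
theorem lawCriterion_holds : LawCriterion := by
  intro Ωδ _ Ω' _ X _ Y P Z P' h f
  refine tendsto_of_subseq_tendsto fun ns hns => ?_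
  obtain ⟨δs, hδpos, hδlim, hδeq⟩ := exists_pos_seq_eventuallyEq hns
  obtain ⟨φ, hφ, hconv⟩ := h δs hδpos hδlim
  exact ⟨φ, (hconv f).congr' ((hφ.tendsto_atTop.eventually hδeq).mono fun n hn =>
    congrArg (fun δ => ∫ ω, f (Y δ ω) ∂P δ) hn)⟩

/-- **Status of target `stub_uniquenessPin`: a theorem** (independent proof): the witness `Γ`
comes from the hypothesis along the harmonic sequence, and every subsequential limit law equals
`preWienerMeasure.map Γ` by `IsSLELaw.eq_map_of_isSLECurve`. Lawler (2005), §6.3. [folklore] -/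
theorem slePin_holds : SLEPin := by
  intro κ D Ωδ _ Y P h
  obtain ⟨-, -, μ₀, ⟨Γ, hΓ, -⟩, -⟩ := h (fun n => 1 / ((n : ℝ) + 1)) (fun n => by positivity)
    tendsto_one_div_add_atTop_nhds_zero_nat
  refine ⟨Γ, hΓ, fun s hs hs0 => ?_⟩
  obtain ⟨φ, hφ, μ, hμ, hlim⟩ := h s hs hs0
  refine ⟨φ, hφ, fun f => ?_⟩
  have hl := hlim f
  rwa [hμ.eq_map_of_isSLECurve hΓ,
    integral_map hΓ.aemeasurable f.continuous.aestronglyMeasurable] at hl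

/-- The set of standard meshes `{1/(m+1) : m ∈ ℕ}`. [folklore] -/
def meshSet : Set ℝ := Set.range fun m : ℕ => 1 / ((m : ℝ) + 1)

theorem oscillator_of_mem {δ : ℝ} (h : δ ∈ meshSet) : oscillator δ = 1 := by
  have h' : δ ∈ Set.range fun m : ℕ => 1 / ((m : ℝ) + 1) := h
  unfold oscillator
  rw [Set.indicator_of_mem h']
  rfl

theorem oscillator_of_not_mem {δ : ℝ} (h : δ ∉ meshSet) : oscillator δ = 0 := by
  have h' : δ ∉ Set.range fun m : ℕ => 1 / ((m : ℝ) + 1) := h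
  unfold oscillator
  rw [Set.indicator_of_notMem h']

/-- The harmonic mesh sequence tends to `0` within `(0, ∞)`. [folklore] -/
theorem tendsto_mesh_nhdsWithin :
    Tendsto (fun n : ℕ => 1 / ((n : ℝ) + 1)) atTop (𝓝[>] (0 : ℝ)) :=
  tendsto_nhdsWithin_iff.2 ⟨tendsto_one_div_add_atTop_nhds_zero_nat,
    Eventually.of_forall fun n => Set.mem_Ioi.2 (by positivity)⟩

/-- The shifted sequence `1/(n+3/2)` (off the mesh set) tends to `0` within `(0, ∞)`. [folklore] -/
theorem tendsto_offmesh_nhdsWithin :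
    Tendsto (fun n : ℕ => 1 / ((n : ℝ) + 3 / 2)) atTop (𝓝[>] (0 : ℝ)) := by
  refine tendsto_nhdsWithin_iff.2 ⟨?_, Eventually.of_forall fun n => Set.mem_Ioi.2 (by positivity)⟩
  have : Tendsto (fun n : ℕ => (n : ℝ) + 3 / 2) atTop atTop :=
    tendsto_atTop_add_const_right _ _ tendsto_natCast_atTop_atTop
  exact tendsto_const_nhds.div_atTop this

/-- A bounded continuous test function on `ℝ` separating `0` from `1`: the clamp
`x ↦ max 0 (min 1 x)`. [folklore] -/
noncomputable def clamp : ℝ →ᵇ ℝ :=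
  BoundedContinuousFunction.ofNormedAddCommGroup (fun x : ℝ => max 0 (min 1 x))
    (continuous_const.max (continuous_const.min continuous_id)) 1 fun x => by
      rw [Real.norm_eq_abs, abs_le]
      exact ⟨by linarith [le_max_left (0 : ℝ) (min 1 x)], max_le zero_le_one (min_le_left _ _)⟩

@[simp] theorem clamp_apply (x : ℝ) : clamp x = max 0 (min 1 x) := rfl

/-- `LawCriterion` with its hypothesis asked ONLY of mesh sequences with values in the standard
mesh set `{1/(m+1)}` (so: of every subsequence of the harmonic mesh sequence, and nothing else).
[folklore] -/
def LawCriterionOnMesh : Prop :=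
  ∀ {Ωδ : ℝ → Type} [∀ δ, MeasurableSpace (Ωδ δ)] {Ω' : Type} [MeasurableSpace Ω']
    {X : Type} [TopologicalSpace X]
    (Y : ∀ δ, Ωδ δ → X) (P : ∀ δ, Measure (Ωδ δ)) (Z : Ω' → X) (P' : Measure Ω'),
    (∀ s : ℕ → ℝ, (∀ n, s n ∈ meshSet) → (∀ n, 0 < s n) → Tendsto s atTop (𝓝 0) →
        ∃ φ : ℕ → ℕ, StrictMono φ ∧ ∀ f : X →ᵇ ℝ,
          Tendsto (fun n ↦ ∫ ω, f (Y (s (φ n)) ω) ∂P (s (φ n))) atTop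
            (𝓝 (∫ ω, f (Z ω) ∂P'))) →
      TendstoLaw Y P Z P'

/-- **Lattice mesh sequences are not enough** (`_false_without_` all positive null sequences):
`LawCriterionOnMesh` is FALSE. Witness: trivial configuration spaces `Unit` with Dirac laws,
deterministic real "interface" `Y δ = oscillator δ` (`1` on the mesh set, `0` off it), limit
`Z = 1`: along every mesh-valued sequence the laws are constantly `δ_1`, yet along `1/(n+3/2)`
they are `δ_0`, so `TendstoLaw` along `𝓝[>] 0` fails (test function `clamp`). Hence any
discharge of (H2) must control ALL positive null mesh sequences, not only `δ = 1/n`. [folklore] -/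
theorem not_lawCriterionOnMesh : ¬ LawCriterionOnMesh := by
  intro h
  have key := @h (fun _ => Unit) (fun _ => inferInstance) Unit _ ℝ _ (fun δ _ => oscillator δ)
    (fun _ => Measure.dirac ()) (fun _ => (1 : ℝ)) (Measure.dirac ()) ?_
  · have h0 : Tendsto (fun _ : ℕ => (0 : ℝ)) atTop
        (𝓝 (∫ _ω : Unit, clamp 1 ∂Measure.dirac ())) :=
      ((key clamp).comp tendsto_offmesh_nhdsWithin).congr fun n => by
        show (∫ _ω : Unit, clamp (oscillator (1 / ((n : ℝ) + 3 / 2))) ∂Measure.dirac ()) = 0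
        rw [oscillator_offmesh n, integral_dirac, clamp_apply]
        norm_num
    have h1 : (∫ _ω : Unit, clamp 1 ∂Measure.dirac ()) = 1 := by
      rw [integral_dirac, clamp_apply]
      norm_num
    rw [h1] at h0
    exact one_ne_zero (tendsto_nhds_unique h0 tendsto_const_nhds)
  · intro s hs _ _
    refine ⟨id, strictMono_id, fun f => ?_⟩
    refine (tendsto_const_nhds (x := ∫ _ω : Unit, f 1 ∂Measure.dirac ())).congr fun n => ?_
    show _ = ∫ _ω : Unit, f (oscillator (s n)) ∂Measure.dirac ()
    rw [oscillator_of_mem (hs n)]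

/-- **`f`-dependent subsequences suffice** (a STRENGTHENING of target `stub_lawCriterion` that
still holds; `Tendsto φ atTop atTop` instead of `StrictMono`): `TendstoLaw` is tested one bounded
continuous function at a time. [folklore] -/
theorem lawCriterion_pointwise {Ωδ : ℝ → Type*} [∀ δ, MeasurableSpace (Ωδ δ)] {Ω' : Type*}
    [MeasurableSpace Ω'] {X : Type*} [TopologicalSpace X]
    (Y : ∀ δ, Ωδ δ → X) (P : ∀ δ, Measure (Ωδ δ)) (Z : Ω' → X) (P' : Measure Ω')
    (h : ∀ f : X →ᵇ ℝ, ∀ s : ℕ → ℝ, (∀ n, 0 < s n) → Tendsto s atTop (𝓝 0) →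
        ∃ φ : ℕ → ℕ, Tendsto φ atTop atTop ∧
          Tendsto (fun n ↦ ∫ ω, f (Y (s (φ n)) ω) ∂P (s (φ n))) atTop (𝓝 (∫ ω, f (Z ω) ∂P'))) :
    TendstoLaw Y P Z P' := by
  intro f
  refine tendsto_of_subseq_tendsto fun ns hns => ?_
  obtain ⟨δs, hδpos, hδlim, hδeq⟩ := exists_pos_seq_eventuallyEq hns
  obtain ⟨φ, hφ, hconv⟩ := h f δs hδpos hδlim
  exact ⟨φ, hconv.congr' ((hφ.eventually hδeq).mono fun n hn =>
    congrArg (fun δ => ∫ ω, f (Y δ ω) ∂P δ) hn)⟩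

/-- **Per-`f` convergent subsequences always exist** (Bolzano–Weierstrass): for probability laws
the real sequence `∫ f (Y (s n) ·) dP (s n)` is bounded by `‖f‖`, so SOME subsequence converges to
SOME real number — with no hypothesis at all. What (H2) adds is the identification of these
limits as `∫ f dμ` for ONE chordal SLE₆ law `μ` (and one subsequence for all `f`). [folklore] -/
theorem exists_subseq_tendsto_integral {Ωδ : ℝ → Type*} [∀ δ, MeasurableSpace (Ωδ δ)]
    {X : Type*} [TopologicalSpace X] (Y : ∀ δ, Ωδ δ → X) (P : ∀ δ, Measure (Ωδ δ))
    [∀ δ, IsProbabilityMeasure (P δ)] (f : X →ᵇ ℝ) (s : ℕ → ℝ) :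
    ∃ L : ℝ, ∃ φ : ℕ → ℕ, StrictMono φ ∧
      Tendsto (fun n ↦ ∫ ω, f (Y (s (φ n)) ω) ∂P (s (φ n))) atTop (𝓝 L) := by
  have hb : ∀ n, (∫ ω, f (Y (s n) ω) ∂P (s n)) ∈ Metric.closedBall (0 : ℝ) ‖f‖ := fun n => by
    rw [Metric.mem_closedBall, dist_zero_right]
    calc ‖∫ ω, f (Y (s n) ω) ∂P (s n)‖ ≤ ‖f‖ * ((P (s n)) Set.univ).toReal :=
          norm_integral_le_of_norm_le_const (Eventually.of_forall fun ω => f.norm_coe_le_norm _)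
      _ = ‖f‖ := by simp
  obtain ⟨L, -, φ, hφ, hL⟩ := tendsto_subseq_of_bounded Metric.isBounded_closedBall hb
  exact ⟨L, φ, hφ, hL⟩

/-- The class of the constant curve at `z`. [folklore] -/
noncomputable def constClass (z : ℂ) : CurveClass ℂ :=
  CurveClass.mk ⟨ContinuousMap.const unitInterval z⟩

@[simp] theorem source_constClass (z : ℂ) : (constClass z).source = z := rfl

theorem constClass_injective : Function.Injective constClass := fun z w h => by
  simpa using congrArg CurveClass.source h

/-- Curve-valued oscillator: the constant curve at `oscillator δ ∈ {0, 1}`. [folklore] -/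
noncomputable def curveOscillator (δ : ℝ) : CurveClass ℂ := constClass (oscillator δ : ℂ)

theorem curveOscillator_of_mem {δ : ℝ} (h : δ ∈ meshSet) : curveOscillator δ = constClass 1 := by
  simp [curveOscillator, oscillator_of_mem h]

theorem curveOscillator_of_not_mem {δ : ℝ} (h : δ ∉ meshSet) :
    curveOscillator δ = constClass 0 := by
  simp [curveOscillator, oscillator_of_not_mem h]

theorem curveOscillator_mesh (n : ℕ) : curveOscillator (1 / ((n : ℝ) + 1)) = constClass 1 :=
  curveOscillator_of_mem (Set.mem_range_self n)

theorem curveOscillator_offmesh (n : ℕ) :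
    curveOscillator (1 / ((n : ℝ) + 3 / 2)) = constClass 0 := by
  unfold curveOscillator
  rw [oscillator_offmesh n]
  simp

/-- A bounded continuous test function on curve classes separating `constClass 0` from
`constClass 1`: truncated distance to `constClass 0`. [folklore] -/
noncomputable def sepTest : CurveClass ℂ →ᵇ ℝ :=
  BoundedContinuousFunction.ofNormedAddCommGroup (fun c => min 1 (dist c (constClass 0)))
    (continuous_const.min (continuous_id.dist continuous_const)) 1 fun c => by
      rw [Real.norm_eq_abs, abs_le]
      exact ⟨by linarith [le_min zero_le_one (dist_nonneg (x := c) (y := constClass 0))],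
        min_le_left _ _⟩

theorem sepTest_constClass_zero : sepTest (constClass 0) = 0 := by
  simp [sepTest]

theorem sepTest_constClass_one_ne_zero : sepTest (constClass 1) ≠ 0 := by
  have hd : 0 < dist (constClass 1) (constClass 0) :=
    dist_pos.2 (constClass_injective.ne one_ne_zero)
  have : 0 < min 1 (dist (constClass 1) (constClass 0)) := lt_min one_pos hd
  simp only [sepTest, BoundedContinuousFunction.coe_ofNormedAddCommGroup]
  exact this.ne'

/-- `SLEPin` with the identification "the subsequential limit law is a chordal SLE_κ law of
`(D; a, b)`" DELETED from the hypothesis (and, necessarily, `IsSLECurve` from the conclusion):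
"every positive null sequence has a subsequence along which the laws converge to SOME law ⇒ one
random variable `Γ` on the pre-Wiener space whose law is every subsequential limit". [folklore] -/
def PinWithoutSLE : Prop :=
  ∀ {Ωδ : ℝ → Type} [∀ δ, MeasurableSpace (Ωδ δ)]
    (Y : ∀ δ, Ωδ δ → CurveClass ℂ) (P : ∀ δ, Measure (Ωδ δ)),
    (∀ s : ℕ → ℝ, (∀ n, 0 < s n) → Tendsto s atTop (𝓝 0) →
        ∃ φ : ℕ → ℕ, StrictMono φ ∧ ∃ μ : Measure (CurveClass ℂ),
          ∀ f : CurveClass ℂ →ᵇ ℝ,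
            Tendsto (fun n ↦ ∫ ω, f (Y (s (φ n)) ω) ∂P (s (φ n))) atTop (𝓝 (∫ x, f x ∂μ))) →
      ∃ Γ : (ℝ≥0 → ℝ) → CurveClass ℂ,
        ∀ s : ℕ → ℝ, (∀ n, 0 < s n) → Tendsto s atTop (𝓝 0) →
          ∃ φ : ℕ → ℕ, StrictMono φ ∧ ∀ f : CurveClass ℂ →ᵇ ℝ,
            Tendsto (fun n ↦ ∫ ω, f (Y (s (φ n)) ω) ∂P (s (φ n))) atTop
              (𝓝 (∫ ω, f (Γ ω) ∂Literature.Probability.Process.preWienerMeasure))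

/-- **Identification of the limit law is load-bearing for the pin**: `PinWithoutSLE` is FALSE.
Witness: `Unit` configuration spaces with Dirac laws and the deterministic curve-valued
oscillator (`constClass 1` on the mesh set, `constClass 0` off it); every positive null sequence
has a subsequence with constant law `δ_{constClass 1}` or `δ_{constClass 0}`, but no single `Γ`
has both as its law (`sepTest` separates them). The measure-level form of
`not_subseqPrinciple_pair`. [folklore] -/
theorem not_pinWithoutSLE : ¬ PinWithoutSLE := by
  intro h
  have key := @h (fun _ => Unit) (fun _ => inferInstance) (fun δ _ => curveOscillator δ)
    (fun _ => Measure.dirac ()) ?_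
  · obtain ⟨Γ, hΓ⟩ := key
    obtain ⟨φ, -, h1⟩ := hΓ (fun n => 1 / ((n : ℝ) + 1)) (fun n => by positivity)
      tendsto_one_div_add_atTop_nhds_zero_nat
    obtain ⟨ψ, -, h0⟩ := hΓ (fun n => 1 / ((n : ℝ) + 3 / 2)) (fun n => by positivity)
      (tendsto_nhdsWithin_iff.1 tendsto_offmesh_nhdsWithin).1
    have e1 : Tendsto (fun _ : ℕ => sepTest (constClass 1)) atTop
        (𝓝 (∫ ω, sepTest (Γ ω) ∂Literature.Probability.Process.preWienerMeasure)) :=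
      (h1 sepTest).congr fun n => by
        show (∫ _ω : Unit, sepTest (curveOscillator (1 / (((φ n : ℕ) : ℝ) + 1)))
          ∂Measure.dirac ()) = _
        rw [curveOscillator_mesh, integral_dirac]
    have e0 : Tendsto (fun _ : ℕ => sepTest (constClass 0)) atTop
        (𝓝 (∫ ω, sepTest (Γ ω) ∂Literature.Probability.Process.preWienerMeasure)) :=
      (h0 sepTest).congr fun n => by
        show (∫ _ω : Unit, sepTest (curveOscillator (1 / (((ψ n : ℕ) : ℝ) + 3 / 2)))
          ∂Measure.dirac ()) = _
        rw [curveOscillator_offmesh, integral_dirac]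
    have := (tendsto_nhds_unique e1 tendsto_const_nhds).symm.trans
      (tendsto_nhds_unique e0 tendsto_const_nhds)
    -- this : sepTest (constClass 1) = sepTest (constClass 0)
    rw [sepTest_constClass_zero] at this
    exact sepTest_constClass_one_ne_zero this
  · intro s _ _
    by_cases hf : ∃ᶠ n in atTop, s n ∈ meshSet
    · obtain ⟨φ, hφ, hφ'⟩ := extraction_of_frequently_atTop hf
      refine ⟨φ, hφ, Measure.dirac (constClass 1), fun f => ?_⟩
      refine (tendsto_const_nhds (x := ∫ x, f x ∂Measure.dirac (constClass 1))).congr fun n => ?_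
      show _ = ∫ _ω : Unit, f (curveOscillator (s (φ n))) ∂Measure.dirac ()
      rw [curveOscillator_of_mem (hφ' n), integral_dirac, integral_dirac]
    · obtain ⟨φ, hφ, hφ'⟩ := extraction_of_eventually_atTop (not_frequently.1 hf)
      refine ⟨φ, hφ, Measure.dirac (constClass 0), fun f => ?_⟩
      refine (tendsto_const_nhds (x := ∫ x, f x ∂Measure.dirac (constClass 0))).congr fun n => ?_
      show _ = ∫ _ω : Unit, f (curveOscillator (s (φ n))) ∂Measure.dirac ()
      rw [curveOscillator_of_not_mem (hφ' n), integral_dirac, integral_dirac]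

end Targets

/-! ## Tightness — the hypothesis of the crux is NECESSARY too (modulo SLE₆ existence)

`hyp_of_concl`: if every Dobrushin domain carries SOME chordal SLE₆ law (the named fact
`exists_isSLECurve` of `SLE.lean` at `κ = 6`, Rohde–Schramm; used only to define the chordal
family at domains without admissible discretisation, which the conclusion never visits), then the
CONCLUSION of the crux implies its HYPOTHESIS (H1) ∧ (H2) — with the identity subsequence. So the
crux is an equivalence (`hyp_iff_concl`): (H2) is not a strengthening that could be traded for
something weaker in substance; every reformulation of the input must still imply full convergence
along `𝓝[>] 0` for every `(D, E)`. -/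
section Tightness

/-- (H1) ∧ (H2): the hypothesis of `SubseqUpgrade`, verbatim. [folklore] -/
def Hyp : Prop :=
  (∀ (D : DobrushinDomain) (E : ℝ → DiscreteDobrushin), ZdDiscretisationFamily D E →
      ∀ᶠ δ in 𝓝[>] (0 : ℝ), AEMeasurable (bondInterfaceIn D (E δ))
        (bondPercolation (zdGraph 2) half)) ∧
    ∀ δs : ℕ → ℝ, (∀ n, 0 < δs n) → Tendsto δs atTop (𝓝 0) →
      ∃ φ : ℕ → ℕ, StrictMono φ ∧ ∃ P : ChordalFamily, (∀ D : DobrushinDomain, IsSLELaw 6 D (P D)) ∧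
        ∀ (D : DobrushinDomain) (E : ℝ → DiscreteDobrushin), ZdDiscretisationFamily D E →
          ∀ f : BoundedContinuousFunction (CurveClass ℂ) ℝ,
            Tendsto (fun n => ∫ ω, f (bondInterfaceIn D (E (δs (φ n))) ω)
              ∂(bondPercolation (zdGraph 2) half)) atTop (𝓝 (∫ γ, f γ ∂(P D)))

/-- The conclusion of `SubseqUpgrade`, verbatim. [folklore] -/
def Concl : Prop :=
  ∀ (D : DobrushinDomain) (E : ℝ → DiscreteDobrushin), ZdDiscretisationFamily D E →
    ConvergesInLawToSLE 6 D (Ωδ := fun _ => BondConfig (Site 2))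
      (fun δ => bondInterfaceIn D (E δ)) (fun _ => bondPercolation (zdGraph 2) half)

/-- The crux IS `Hyp → Concl` (definitionally). [folklore] -/
theorem subseqUpgrade_iff_hyp_concl :
    Summit.CriticalPhenomena.CardyFormulaZ2.Theses.CardySelfRefinement.SubseqUpgrade ↔
      (Hyp → Concl) :=
  Iff.rfl

/-- SLE₆ laws exist in every Dobrushin domain, from the named existence fact `exists_isSLECurve`
(Rohde–Schramm 2005, Thms 5.1, 7.1; Lawler 2005, §6.3). [cite: RohdeSchramm2005] -/
theorem forall_exists_isSLELaw_six (hex : exists_isSLECurve) :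
    ∀ D : DobrushinDomain, ∃ μ : Measure (CurveClass ℂ), IsSLELaw 6 D μ := fun D => by
  obtain ⟨Γ, hΓ⟩ := hex (κ := 6) (by norm_num) D
  exact ⟨_, hΓ.isSLELaw_map⟩

/-- **Converse of the crux** (tightness): modulo an SLE₆ law in every Dobrushin domain, the
conclusion implies (H1) ∧ (H2), with `φ = id` and the chordal family chosen once for all
sequences. Uses uniqueness `IsSLELaw.eq_map_of_isSLECurve` to match the chosen family with the
limit curve of the conclusion. [folklore] -/
theorem hyp_of_concl (hex : ∀ D : DobrushinDomain, ∃ μ : Measure (CurveClass ℂ), IsSLELaw 6 D μ)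
    (hC : Concl) : Hyp := by
  choose Pfam hPfam using hex
  refine ⟨fun D E hDE => ?_, fun δs hpos hlim => ⟨id, strictMono_id, Pfam, hPfam, ?_⟩⟩
  · obtain ⟨-, -, hmeas, -⟩ := hC D E hDE
    exact hmeas
  · intro D E hDE f
    obtain ⟨Γ, hΓ, -, hT⟩ := hC D E hDE
    have hδ : Tendsto δs atTop (𝓝[>] (0 : ℝ)) :=
      tendsto_nhdsWithin_iff.2 ⟨hlim, Eventually.of_forall fun n => Set.mem_Ioi.2 (hpos n)⟩
    rw [(hPfam D).eq_map_of_isSLECurve hΓ,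
      integral_map hΓ.aemeasurable f.continuous.aestronglyMeasurable]
    exact (hT f).comp hδ

/-- **The crux is an equivalence** modulo SLE₆ existence: (H1) ∧ (H2) ⟺ conclusion. [folklore] -/
theorem hyp_iff_concl (hex : ∀ D : DobrushinDomain, ∃ μ : Measure (CurveClass ℂ), IsSLELaw 6 D μ) :
    Hyp ↔ Concl :=
  ⟨fun h => subseqUpgrade_iff_hyp_concl.1 subseqUpgrade_holds' h, hyp_of_concl hex⟩

end Tightness

/-! ## Cycle3 — hits, the mesh-set dichotomy, and (H1) is free

Landing copy (definition-free, namespace `…Theorems.SubseqUpgrade.Negative`):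
`Theorems/SubseqUpgrade/Negative/MeshSetsAndHits.lean`. -/
section Cycle3

/-! ### The weakest subsequence principle: hits suffice, and are necessary -/

/-- **`TendstoLaw` ⟺ every positive null mesh sequence hits every neighbourhood of the limit
statistic.** For every bounded continuous `f`, every `U ∈ 𝓝 (∫ f (Z ·) dP')` and every
everywhere-positive null sequence `s`, some index `n` has `∫ f (Y (s n) ·) dP (s n) ∈ U`. The
forward direction is trivial; the converse is the contrapositive of the definition of the limit
along the countably generated filter `𝓝[>] 0` (`exists_seq_forall_of_frequently`). Hence in any
subsequence principle for `TendstoLaw` the reindexing map may be ARBITRARY (not `StrictMono`, not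
even tending to `∞`) and may depend on `f`. Billingsley (1999), Thm. 2.6. [folklore] -/
theorem tendstoLaw_iff_forall_seq_exists_mem {Ωδ : ℝ → Type*} [∀ δ, MeasurableSpace (Ωδ δ)]
    {Ω' : Type*} [MeasurableSpace Ω'] {X : Type*} [TopologicalSpace X]
    (Y : ∀ δ, Ωδ δ → X) (P : ∀ δ, Measure (Ωδ δ)) (Z : Ω' → X) (P' : Measure Ω') :
    TendstoLaw Y P Z P' ↔
      ∀ f : X →ᵇ ℝ, ∀ U ∈ 𝓝 (∫ ω, f (Z ω) ∂P'), ∀ s : ℕ → ℝ, (∀ n, 0 < s n) →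
        Tendsto s atTop (𝓝 0) → ∃ n, (∫ ω, f (Y (s n) ω) ∂P (s n)) ∈ U := by
  constructor
  · intro h f U hU s hs hs0
    have hs' : Tendsto s atTop (𝓝[>] (0 : ℝ)) :=
      tendsto_nhdsWithin_iff.2 ⟨hs0, Eventually.of_forall fun n => Set.mem_Ioi.2 (hs n)⟩
    exact (((h f).comp hs').eventually_mem hU).exists
  · intro h f
    by_contra hnot
    rw [tendsto_iff_forall_eventually_mem] at hnot
    simp only [not_forall] at hnot
    obtain ⟨U, hU, hfreq⟩ := hnot
    have hfr : ∃ᶠ δ in 𝓝[>] (0 : ℝ), (∫ ω, f (Y δ ω) ∂P δ) ∉ U ∧ δ ∈ Set.Ioi (0 : ℝ) :=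
      (not_eventually.1 hfreq).and_eventually eventually_mem_nhdsWithin
    obtain ⟨ns, hns, hboth⟩ := exists_seq_forall_of_frequently hfr
    obtain ⟨n, hn⟩ := h f U hU ns (fun n => (hboth n).2) (tendsto_nhds_of_tendsto_nhdsWithin hns)
    exact (hboth n).1 hn

/-- **Every everywhere-positive null sequence has a strictly decreasing subsequence** (infinitary
Erdős–Szekeres, `exists_increasing_or_nonincreasing_subseq'`: the other alternative, a
non-decreasing subsequence, is impossible for a positive sequence tending to `0`). [folklore] -/
theorem exists_strictAnti_subseq {s : ℕ → ℝ} (hs : ∀ n, 0 < s n)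
    (hs0 : Tendsto s atTop (𝓝 0)) : ∃ g : ℕ → ℕ, StrictMono g ∧ StrictAnti (s ∘ g) := by
  obtain ⟨g, h | h⟩ := exists_increasing_or_nonincreasing_subseq' (fun a b : ℝ => b < a) s
  · exact ⟨g, g.strictMono, strictAnti_nat_of_succ_lt fun n => h n⟩
  · exfalso
    have hle : ∀ n, s (g 0) ≤ s (g (n + 1)) := fun n => not_lt.1 (h 0 (n + 1) n.succ_pos)
    have hlim : Tendsto (fun n => s (g (n + 1))) atTop (𝓝 0) :=
      (hs0.comp g.strictMono.tendsto_atTop).comp (tendsto_add_atTop_nat 1)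
    have hev := hlim.eventually (gt_mem_nhds (hs (g 0)))
    obtain ⟨n, hn⟩ := hev.exists
    exact (not_lt.2 (hle n)) hn

/-- A sequence tending to `0` within `(0, ∞)` is eventually inside any `T ∈ 𝓝[>] 0` and has a
STRICTLY DECREASING subsequence with all its values in `T`. [folklore] -/
theorem exists_strictAnti_subseq_mem {T : Set ℝ} (hT : T ∈ 𝓝[>] (0 : ℝ)) {ns : ℕ → ℝ}
    (hns : Tendsto ns atTop (𝓝[>] (0 : ℝ))) :
    ∃ g : ℕ → ℕ, StrictMono g ∧ StrictAnti (ns ∘ g) ∧ (∀ n, ns (g n) ∈ T) ∧ ∀ n, 0 < ns (g n) := by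
  have hev : ∀ᶠ n in atTop, ns n ∈ T ∧ ns n ∈ Set.Ioi (0 : ℝ) :=
    (hns.eventually_mem hT).and (hns.eventually_mem self_mem_nhdsWithin)
  obtain ⟨N, hN⟩ := eventually_atTop.1 hev
  have hpos : ∀ n, 0 < ns (n + N) := fun n => (hN _ (Nat.le_add_left N n)).2
  have hlim : Tendsto (fun n => ns (n + N)) atTop (𝓝 0) :=
    (tendsto_nhds_of_tendsto_nhdsWithin hns).comp (tendsto_add_atTop_nat N)
  obtain ⟨g, hg, hanti⟩ := exists_strictAnti_subseq hpos hlim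
  refine ⟨fun n => g n + N, fun a b hab => Nat.add_lt_add_right (hg hab) N, hanti,
    fun n => (hN _ (Nat.le_add_left N (g n))).1, fun n => hpos (g n)⟩

/-- **Strictly decreasing sequences inside a right-neighbourhood of `0` suffice** (the sharpest
sufficient class of mesh sequences, in the weakest "hit" form): if `T ∈ 𝓝[>] 0` and every
strictly decreasing, `T`-valued, everywhere-positive null sequence hits every neighbourhood of
the limit statistic of every test function, then `TendstoLaw Y P Z P'`. So an upstream discharge
of hypothesis (H2) of the crux may assume the mesh sequence strictly decreasing and below any
fixed `ε`. Billingsley (1999), Thm. 2.6. [folklore] -/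
theorem tendstoLaw_of_hits_on {Ωδ : ℝ → Type*} [∀ δ, MeasurableSpace (Ωδ δ)]
    {Ω' : Type*} [MeasurableSpace Ω'] {X : Type*} [TopologicalSpace X]
    {Y : ∀ δ, Ωδ δ → X} {P : ∀ δ, Measure (Ωδ δ)} {Z : Ω' → X} {P' : Measure Ω'}
    {T : Set ℝ} (hT : T ∈ 𝓝[>] (0 : ℝ))
    (h : ∀ f : X →ᵇ ℝ, ∀ U ∈ 𝓝 (∫ ω, f (Z ω) ∂P'), ∀ s : ℕ → ℝ, StrictAnti s →
      (∀ n, s n ∈ T) → (∀ n, 0 < s n) → Tendsto s atTop (𝓝 0) →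
        ∃ n, (∫ ω, f (Y (s n) ω) ∂P (s n)) ∈ U) :
    TendstoLaw Y P Z P' := by
  refine (tendstoLaw_iff_forall_seq_exists_mem Y P Z P').2 fun f U hU s hs hs0 => ?_
  have hs' : Tendsto s atTop (𝓝[>] (0 : ℝ)) :=
    tendsto_nhdsWithin_iff.2 ⟨hs0, Eventually.of_forall fun n => Set.mem_Ioi.2 (hs n)⟩
  obtain ⟨g, hg, hanti, hmem, hpos⟩ := exists_strictAnti_subseq_mem hT hs'
  obtain ⟨n, hn⟩ := h f U hU (s ∘ g) hanti hmem hpos (hs0.comp hg.tendsto_atTop)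
  exact ⟨g n, hn⟩

/-- The subsequence form: the law criterion with its hypothesis asked only of strictly
decreasing `T`-valued sequences, `T ∈ 𝓝[>] 0` (and an arbitrary, possibly `f`-dependent
reindexing). [folklore] -/
theorem tendstoLaw_of_subseq_on {Ωδ : ℝ → Type*} [∀ δ, MeasurableSpace (Ωδ δ)]
    {Ω' : Type*} [MeasurableSpace Ω'] {X : Type*} [TopologicalSpace X]
    {Y : ∀ δ, Ωδ δ → X} {P : ∀ δ, Measure (Ωδ δ)} {Z : Ω' → X} {P' : Measure Ω'}
    {T : Set ℝ} (hT : T ∈ 𝓝[>] (0 : ℝ))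
    (h : ∀ s : ℕ → ℝ, StrictAnti s → (∀ n, s n ∈ T) → (∀ n, 0 < s n) →
      Tendsto s atTop (𝓝 0) → ∀ f : X →ᵇ ℝ, ∃ φ : ℕ → ℕ,
        Tendsto (fun n ↦ ∫ ω, f (Y (s (φ n)) ω) ∂P (s (φ n))) atTop (𝓝 (∫ ω, f (Z ω) ∂P'))) :
    TendstoLaw Y P Z P' := by
  refine tendstoLaw_of_hits_on hT fun f U hU s hanti hmem hs hs0 => ?_
  obtain ⟨φ, hφ⟩ := h s hanti hmem hs hs0 f
  obtain ⟨n, hn⟩ := (hφ.eventually_mem hU).exists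
  exact ⟨φ n, hn⟩

/-! ### The dichotomy: mesh sets `T ∉ 𝓝[>] 0` never suffice -/

/-- `LawCriterion` (target `stub_lawCriterion`, item 6) with its hypothesis asked ONLY of mesh
sequences with values in `T` — the strongest hypothesis form (one `StrictMono` subsequence for
all test functions). `LawCriterionOnMesh` of cycle 2 is `LawCriterionOn meshSet`. [folklore] -/
def LawCriterionOn (T : Set ℝ) : Prop :=
  ∀ {Ωδ : ℝ → Type} [∀ δ, MeasurableSpace (Ωδ δ)] {Ω' : Type} [MeasurableSpace Ω']
    {X : Type} [TopologicalSpace X]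
    (Y : ∀ δ, Ωδ δ → X) (P : ∀ δ, Measure (Ωδ δ)) (Z : Ω' → X) (P' : Measure Ω'),
    (∀ s : ℕ → ℝ, (∀ n, s n ∈ T) → (∀ n, 0 < s n) → Tendsto s atTop (𝓝 0) →
        ∃ φ : ℕ → ℕ, StrictMono φ ∧ ∀ f : X →ᵇ ℝ,
          Tendsto (fun n ↦ ∫ ω, f (Y (s (φ n)) ω) ∂P (s (φ n))) atTop
            (𝓝 (∫ ω, f (Z ω) ∂P'))) →
      TendstoLaw Y P Z P'

/-- **No set of meshes which is not a right-neighbourhood of `0` suffices**: for `T ∉ 𝓝[>] 0`,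
`LawCriterionOn T` is FALSE. Witness: `Unit` configuration spaces with Dirac laws, the
deterministic real "interface" `T.indicator 1` and limit `Z = 1`: along `T`-valued sequences the
laws are constantly `δ_1`, but `T ∉ 𝓝[>] 0` yields a sequence `ns → 0⁺` avoiding `T`
(`exists_seq_forall_of_frequently`), along which they are `δ_0` (test function `clamp`).
[folklore] -/
theorem not_lawCriterionOn_of_not_mem_nhdsWithin {T : Set ℝ} (hT : T ∉ 𝓝[>] (0 : ℝ)) :
    ¬ LawCriterionOn T := by
  intro h
  have hfr : ∃ᶠ δ in 𝓝[>] (0 : ℝ), δ ∉ T := not_eventually.1 (mt eventually_mem_set.1 hT)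
  obtain ⟨ns, hns, hnsT⟩ := exists_seq_forall_of_frequently hfr
  have key := @h (fun _ => Unit) (fun _ => inferInstance) Unit _ ℝ _
    (fun δ _ => T.indicator (1 : ℝ → ℝ) δ) (fun _ => Measure.dirac ()) (fun _ => (1 : ℝ))
    (Measure.dirac ()) ?_
  · have h0 : Tendsto (fun _ : ℕ => (0 : ℝ)) atTop (𝓝 (∫ _ω : Unit, clamp 1 ∂Measure.dirac ())) :=
      ((key clamp).comp hns).congr fun n => by
        show (∫ _ω : Unit, clamp (T.indicator 1 (ns n)) ∂Measure.dirac ()) = 0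
        rw [Set.indicator_of_notMem (hnsT n), integral_dirac, clamp_apply]
        norm_num
    have h1 : (∫ _ω : Unit, clamp 1 ∂Measure.dirac ()) = 1 := by
      rw [integral_dirac, clamp_apply]
      norm_num
    rw [h1] at h0
    exact one_ne_zero (tendsto_nhds_unique h0 tendsto_const_nhds)
  · intro s hs _ _
    refine ⟨id, strictMono_id, fun f => ?_⟩
    refine (tendsto_const_nhds (x := ∫ _ω : Unit, f 1 ∂Measure.dirac ())).congr fun n => ?_
    show _ = ∫ _ω : Unit, f (T.indicator 1 (s n)) ∂Measure.dirac ()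
    rw [Set.indicator_of_mem (hs n)]
    rfl

/-- **Right-neighbourhoods of `0` suffice** (even through strictly decreasing sequences and
`f`-dependent arbitrary reindexing, `tendstoLaw_of_subseq_on`). [folklore] -/
theorem lawCriterionOn_of_mem_nhdsWithin {T : Set ℝ} (hT : T ∈ 𝓝[>] (0 : ℝ)) :
    LawCriterionOn T := by
  intro Ωδ _ Ω' _ X _ Y P Z P' hyp
  refine tendstoLaw_of_subseq_on hT fun s _ hmem hs hs0 f => ?_
  obtain ⟨φ, -, hφ⟩ := hyp s hmem hs hs0
  exact ⟨φ, hφ f⟩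

/-- **THE DICHOTOMY**: the mesh sequences with values in `T` suffice for the law criterion iff
`T` is a right-neighbourhood of `0`. [folklore] -/
theorem lawCriterionOn_iff {T : Set ℝ} : LawCriterionOn T ↔ T ∈ 𝓝[>] (0 : ℝ) :=
  ⟨fun h => by_contra fun hT => not_lawCriterionOn_of_not_mem_nhdsWithin hT h,
    lawCriterionOn_of_mem_nhdsWithin⟩

/-- A countable set of reals is not a right-neighbourhood of `0`: such a neighbourhood contains
an interval `(0, u)`, `u > 0`, which is uncountable (`Cardinal.Real.Ioo_countable_iff`).
[folklore] -/
theorem not_mem_nhdsWithin_Ioi_of_countable {T : Set ℝ} (hT : T.Countable) :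
    T ∉ 𝓝[>] (0 : ℝ) := by
  intro h
  obtain ⟨u, hu, hsub⟩ := mem_nhdsGT_iff_exists_Ioo_subset.1 h
  have hc : (Set.Ioo (0 : ℝ) u).Countable := hT.mono hsub
  rw [Cardinal.Real.Ioo_countable_iff] at hc
  exact absurd hc (not_le.2 hu)

/-- **No countable set of meshes suffices**: hypothesis (H2) of the crux needs a continuum of
meshes. [folklore] -/
theorem not_lawCriterionOn_of_countable {T : Set ℝ} (hT : T.Countable) : ¬ LawCriterionOn T :=
  not_lawCriterionOn_of_not_mem_nhdsWithin (not_mem_nhdsWithin_Ioi_of_countable hT)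

/-- **The values of one mesh sequence never suffice** (`1/(m+1)`, `2⁻ⁿ`, all subsequences of
any fixed sequence, …): the range of a sequence is countable. [folklore] -/
theorem not_lawCriterionOn_range (u : ℕ → ℝ) : ¬ LawCriterionOn (Set.range u) :=
  not_lawCriterionOn_of_countable (Set.countable_range u)

/-- Item 7 recovered: the lattice meshes `{1/(m+1)}` do not suffice
(`LawCriterionOnMesh = LawCriterionOn meshSet` definitionally). [folklore] -/
theorem not_lawCriterionOn_meshSet : ¬ LawCriterionOn meshSet :=
  not_lawCriterionOn_range _

/-- The meshes below any fixed `ε > 0` suffice. [folklore] -/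
theorem lawCriterionOn_Ioo {ε : ℝ} (hε : 0 < ε) : LawCriterionOn (Set.Ioo 0 ε) :=
  lawCriterionOn_of_mem_nhdsWithin (Ioo_mem_nhdsGT hε)

/-! ### (H1) is free: the bond interface is measurable, unconditionally -/

/-- **The bond interface is Borel measurable**, for every Dobrushin domain `D` and EVERY discrete
Dobrushin domain `E` (no admissibility, finiteness or positive-mesh hypothesis): it is a function
of the medial exploration `medialExploration E ω`, a measurable map into a countable discrete
space (`measurable_of_medialExploration`). Aizenman–Burchard (1999), §2.1. [folklore] -/
theorem measurable_bondInterfaceIn_all (D : DobrushinDomain) (E : DiscreteDobrushin) :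
    Measurable (bondInterfaceIn D E) :=
  measurable_of_medialExploration E fun ω ω' h => by
    rw [bondInterfaceIn_apply, bondInterfaceIn_apply, medialExplorationCurve_congr h]

/-- **Hypothesis (H1) of `SubseqUpgrade` is a theorem** (verbatim; the discretisation-family
hypothesis is not even used). [folklore] -/
theorem subseqUpgrade_h1 :
    ∀ (D : DobrushinDomain) (E : ℝ → DiscreteDobrushin), ZdDiscretisationFamily D E →
      ∀ᶠ δ in 𝓝[>] (0 : ℝ), AEMeasurable (bondInterfaceIn D (E δ))
        (bondPercolation (zdGraph 2) half) :=
  fun D E _ => Eventually.of_forall fun δ => (measurable_bondInterfaceIn_all D (E δ)).aemeasurable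

/-- (H2): the second conjunct of the hypothesis of `SubseqUpgrade`, verbatim. [folklore] -/
def H2 : Prop :=
  ∀ δs : ℕ → ℝ, (∀ n, 0 < δs n) → Tendsto δs atTop (𝓝 0) →
    ∃ φ : ℕ → ℕ, StrictMono φ ∧ ∃ P : ChordalFamily, (∀ D : DobrushinDomain, IsSLELaw 6 D (P D)) ∧
      ∀ (D : DobrushinDomain) (E : ℝ → DiscreteDobrushin), ZdDiscretisationFamily D E →
        ∀ f : BoundedContinuousFunction (CurveClass ℂ) ℝ,
          Tendsto (fun n => ∫ ω, f (bondInterfaceIn D (E (δs (φ n))) ω)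
            ∂(bondPercolation (zdGraph 2) half)) atTop (𝓝 (∫ γ, f γ ∂(P D)))

/-- **The hypothesis of the crux is (H2) alone**: `Hyp ↔ H2`, since (H1) is a theorem.
[folklore] -/
theorem hyp_iff_h2 : Hyp ↔ H2 :=
  ⟨fun h => h.2, fun h => ⟨subseqUpgrade_h1, h⟩⟩

/-! ### The weakest hypothesis for the crux: SLE₆ hits, and their necessity -/

/-- (H2) in HIT form: for every everywhere-positive null mesh sequence a family of chordal SLE₆
laws such that, for every admissible `(D, E)`, every test function `f` and every `ε > 0`, SOME
mesh of the sequence has its `f`-statistic `ε`-close to the SLE₆ value. No (H1), no subsequence,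
no `StrictMono`, no simultaneity in `f`. [folklore] -/
def H2Hit : Prop :=
  ∀ δs : ℕ → ℝ, (∀ n, 0 < δs n) → Tendsto δs atTop (𝓝 0) →
    ∃ P : ChordalFamily, (∀ D : DobrushinDomain, IsSLELaw 6 D (P D)) ∧
      ∀ (D : DobrushinDomain) (E : ℝ → DiscreteDobrushin), ZdDiscretisationFamily D E →
        ∀ f : CurveClass ℂ →ᵇ ℝ, ∀ ε > (0 : ℝ), ∃ n,
          |(∫ ω, f (bondInterfaceIn D (E (δs n)) ω) ∂(bondPercolation (zdGraph 2) half)) -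
            ∫ γ, f γ ∂(P D)| < ε

/-- (H2) implies its hit form (evaluate the subsequence's eventual `ε`-closeness at one index).
[folklore] -/
theorem h2Hit_of_h2 (h : H2) : H2Hit := by
  intro δs hpos hlim
  obtain ⟨φ, -, P, hP, hconv⟩ := h δs hpos hlim
  refine ⟨P, hP, fun D E hDE f ε hε => ?_⟩
  obtain ⟨n, hn⟩ := (Metric.tendsto_atTop.1 (hconv D E hDE f)) ε hε
  exact ⟨φ n, by simpa [Real.dist_eq] using hn n le_rfl⟩

/-- **The crux from hits alone**: `H2Hit → Concl` (uniqueness `IsSLELaw.eq_map_of_isSLECurve` +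
`tendstoLaw_iff_forall_seq_exists_mem` + `subseqUpgrade_h1`). [folklore] -/
theorem concl_of_h2Hit (h : H2Hit) : Concl := by
  intro D E hDE
  obtain ⟨P₀, hP₀, -⟩ := h (fun n => 1 / ((n : ℝ) + 1)) (fun n => by positivity)
    tendsto_one_div_add_atTop_nhds_zero_nat
  obtain ⟨Γ, hΓ, -⟩ := hP₀ D
  refine ⟨Γ, hΓ, subseqUpgrade_h1 D E hDE, ?_⟩
  refine (tendstoLaw_iff_forall_seq_exists_mem _ _ _ _).2 fun f U hU s hs hs0 => ?_
  obtain ⟨P, hP, hhit⟩ := h s hs hs0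
  obtain ⟨ε, hε, hball⟩ := Metric.mem_nhds_iff.1 hU
  obtain ⟨n, hn⟩ := hhit D E hDE f ε hε
  refine ⟨n, hball ?_⟩
  rw [Metric.mem_ball, Real.dist_eq,
    ← integral_map hΓ.aemeasurable f.continuous.aestronglyMeasurable,
    ← (hP D).eq_map_of_isSLECurve hΓ]
  exact hn

/-- **The crux from hits along strictly decreasing meshes below `ε` only** (the directly
consumable strengthening for the upstream discharge of (H2)): it suffices that for every
STRICTLY DECREASING mesh sequence with values in `(0, ε)` there is a family of chordal SLE₆ laws
whose `f`-statistics are hit `ε'`-closely at some mesh of the sequence, for every admissible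
`(D, E)`, every `f` and every `ε' > 0`. (`tendstoLaw_of_hits_on` with `T = Set.Ioo 0 ε`; the SLE₆
curve of `D` is read off at the sequence `ε/(n+2)`.) [folklore] -/
theorem concl_of_h2Hit_on {ε : ℝ} (hε : 0 < ε)
    (h : ∀ δs : ℕ → ℝ, StrictAnti δs → (∀ n, δs n ∈ Set.Ioo 0 ε) → (∀ n, 0 < δs n) →
      Tendsto δs atTop (𝓝 0) →
      ∃ P : ChordalFamily, (∀ D : DobrushinDomain, IsSLELaw 6 D (P D)) ∧
        ∀ (D : DobrushinDomain) (E : ℝ → DiscreteDobrushin), ZdDiscretisationFamily D E →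
          ∀ f : CurveClass ℂ →ᵇ ℝ, ∀ ε' > (0 : ℝ), ∃ n,
            |(∫ ω, f (bondInterfaceIn D (E (δs n)) ω) ∂(bondPercolation (zdGraph 2) half)) -
              ∫ γ, f γ ∂(P D)| < ε') :
    Concl := by
  intro D E hDE
  -- the SLE₆ curve of `D`, from the strictly decreasing sequence `ε / (n + 2)` in `(0, ε)`
  have h2pos : ∀ n : ℕ, (0 : ℝ) < (n : ℝ) + 2 := fun n => by positivity
  have hanti0 : StrictAnti fun n : ℕ => ε / ((n : ℝ) + 2) := fun a b hab =>
    div_lt_div_of_pos_left hε (h2pos a) (by exact_mod_cast Nat.add_lt_add_right hab 2)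
  have hmem0 : ∀ n : ℕ, ε / ((n : ℝ) + 2) ∈ Set.Ioo 0 ε := fun n =>
    ⟨div_pos hε (h2pos n), (div_lt_self hε (by linarith))⟩
  have hlim0 : Tendsto (fun n : ℕ => ε / ((n : ℝ) + 2)) atTop (𝓝 0) :=
    tendsto_const_nhds.div_atTop (tendsto_atTop_add_const_right _ _ tendsto_natCast_atTop_atTop)
  obtain ⟨P₀, hP₀, -⟩ := h _ hanti0 hmem0 (fun n => (hmem0 n).1) hlim0
  obtain ⟨Γ, hΓ, -⟩ := hP₀ D
  refine ⟨Γ, hΓ, subseqUpgrade_h1 D E hDE, ?_⟩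
  refine tendstoLaw_of_hits_on (Ioo_mem_nhdsGT hε) fun f U hU s hanti hmem hs hs0 => ?_
  obtain ⟨P, hP, hhit⟩ := h s hanti hmem hs hs0
  obtain ⟨ε', hε', hball⟩ := Metric.mem_nhds_iff.1 hU
  obtain ⟨n, hn⟩ := hhit D E hDE f ε' hε'
  refine ⟨n, hball ?_⟩
  rw [Metric.mem_ball, Real.dist_eq,
    ← integral_map hΓ.aemeasurable f.continuous.aestronglyMeasurable,
    ← (hP D).eq_map_of_isSLECurve hΓ]
  exact hn

/-- **A seventh proof of the crux, through the weakest interface** (hits). [folklore] -/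
theorem subseqUpgrade_of_hits :
    Summit.CriticalPhenomena.CardyFormulaZ2.Theses.CardySelfRefinement.SubseqUpgrade :=
  fun h => concl_of_h2Hit (h2Hit_of_h2 h.2)

/-- **Necessity of the hits** (modulo an SLE₆ law in every Dobrushin domain): `Concl → H2Hit`,
with one chordal family for all sequences. [folklore] -/
theorem h2Hit_of_concl (hex : ∀ D : DobrushinDomain, ∃ μ : Measure (CurveClass ℂ), IsSLELaw 6 D μ)
    (hC : Concl) : H2Hit := by
  choose Pfam hPfam using hex
  intro δs hpos hlim
  refine ⟨Pfam, hPfam, fun D E hDE f ε hε => ?_⟩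
  obtain ⟨Γ, hΓ, -, hT⟩ := hC D E hDE
  have hδ : Tendsto δs atTop (𝓝[>] (0 : ℝ)) :=
    tendsto_nhdsWithin_iff.2 ⟨hlim, Eventually.of_forall fun n => Set.mem_Ioi.2 (hpos n)⟩
  have hlimf := (hT f).comp hδ
  rw [← integral_map hΓ.aemeasurable f.continuous.aestronglyMeasurable,
    ← (hPfam D).eq_map_of_isSLECurve hΓ] at hlimf
  obtain ⟨n, hn⟩ := (Metric.tendsto_atTop.1 hlimf) ε hε
  exact ⟨n, by simpa [Real.dist_eq] using hn n le_rfl⟩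

/-- **In substance the crux is the equivalence `H2Hit ⟺ Concl`** (modulo SLE₆ existence), and
`H2Hit` is the weakest hypothesis from which it can be proved. [folklore] -/
theorem h2Hit_iff_concl (hex : ∀ D : DobrushinDomain, ∃ μ : Measure (CurveClass ℂ), IsSLELaw 6 D μ) :
    H2Hit ↔ Concl :=
  ⟨concl_of_h2Hit, h2Hit_of_concl hex⟩

end Cycle3

end Summit.CriticalPhenomena.CardyFormulaZ2.Cruxes.SubseqUpgrade.Disproof
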